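import Summits.PneNP.PneNP.Theorems.EfNotPOptimalEFProofSearchOfCollapseDefs
import HarnessLib

/-!
# EF proof search under `P = NP` (item `EFProofSearchOfCollapse`), I: canonical certificates are EF proofs; counting inferred lines

Support file 1/5 for stmt-PneNP-18943 (definitions in `…Defs`).

* `xvar L j` has numeral `1^{L+j+1}` (`encodeNat_xvar`); variables of `φ` have numerals shorter than
  `|encode φ|` (`length_encodeNat_lt_length_encode`);
* `isEFProofOf_extLines_append` (soundness side of the certificate format): canonical extension lines
  with strictly increasing indices whose bodies only use variables with numerals of length `≤ L + j`,
  followed by lines each inferred from the earlier ones and ending with `φ` (all variables of `φ`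
  having numerals of length `< L`), form an extended-Frege proof of `φ` — freshness of `xvar L j`
  (numeral length `L + j + 1`) is a length comparison;
* `length_translForms_unitTable_append`: with the unit table the Cook–Reckhow translation
  (`FregeTransl.translForms`, tree) emits exactly one line per INFERRED line, so comparing lengths
  decides "every line of `P` is inferred from `E` and the earlier lines of `P`".

References: S. A. Cook, R. A. Reckhow, *The relative efficiency of propositional proof systems*,
JSL 44 (1979), §1 (Def. 1.5: the class `𝓛` of polynomial-time functions), §2 (Lemma 2.5, Thm. 2.3),
§4 (Def. 4.1: the extension rule); J. Krajíček, *Bounded arithmetic, propositional logic, and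
complexity theory* (CUP 1995), Def. 4.5.2; S. Arora, B. Barak, *Computational Complexity* (CUP 2009),
Thm. 2.18 (decision versus search).
-/

set_option linter.dupNamespace false

namespace Summit.PneNP.PneNP.Theorems.EFProofSearch

open _root_.Computability Literature.Computability.Complexity Literature.Computability.MetaComplexity
open Literature.Barriers.QuantumAdvantage.TQBFEval (varOcc)


/-! ### Canonical extension variables -/

/-- The numeral of `xvar L j` is `1^{L+j+1}`. -/
theorem encodeNat_xvar (L j : ℕ) : encodeNat (xvar L j) = List.replicate (L + j + 1) true :=
  encodeNat_decodeNat (Or.inr (by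
    rw [List.getLast?_eq_some_getLast (List.ne_nil_of_length_eq_add_one List.length_replicate),
      List.getLast_replicate_succ]))

/-- The numeral of `xvar L j` has length `L + j + 1`. -/
theorem length_encodeNat_xvar (L j : ℕ) : (encodeNat (xvar L j)).length = L + j + 1 := by
  rw [encodeNat_xvar, List.length_replicate]

/-! ### Variables of a formula and their numerals -/

/-- The finite set of variables `PropForm.vars` and the occurrence list `varOcc` have the same
members. -/
theorem mem_vars_iff_mem_varOcc (φ : PropForm ℕ) (v : ℕ) : v ∈ φ.vars ↔ v ∈ varOcc φ := by
  induction φ with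
  | var x => simp [PropForm.vars, varOcc]
  | const b => simp [PropForm.vars, varOcc]
  | neg φ ih => simpa [PropForm.vars, varOcc] using ih
  | conj φ ψ ih₁ ih₂ => simp [PropForm.vars, varOcc, ih₁, ih₂]
  | disj φ ψ ih₁ ih₂ => simp [PropForm.vars, varOcc, ih₁, ih₂]

/-- A variable occurrence costs `2 |bin v| + 4` bits of the prefix code. -/
theorem length_encodeNat_le_code {φ : PropForm ℕ} {v : ℕ} (hv : v ∈ φ.vars) :
    2 * (encodeNat v).length + 4 ≤ φ.code.length := by
  induction φ with
  | var x =>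
    simp only [PropForm.vars, Finset.mem_singleton] at hv
    subst hv
    simp [PropForm.code, length_boolPair]
  | const b => simp [PropForm.vars] at hv
  | neg φ ih =>
    have := ih (by simpa [PropForm.vars] using hv)
    simp only [PropForm.code, List.length_cons]
    omega
  | conj φ ψ ih₁ ih₂ =>
    simp only [PropForm.vars, Finset.mem_union] at hv
    simp only [PropForm.code, List.length_cons, List.length_append]
    rcases hv with hv | hv
    · have := ih₁ hv; omega
    · have := ih₂ hv; omega
  | disj φ ψ ih₁ ih₂ =>
    simp only [PropForm.vars, Finset.mem_union] at hv
    simp only [PropForm.code, List.length_cons, List.length_append]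
    rcases hv with hv | hv
    · have := ih₁ hv; omega
    · have := ih₂ hv; omega

/-- The length of the code word of a formula: `|⟨1^{|φ|}, code φ⟩| = 2|φ| + 2 + |code φ|`. -/
theorem length_encode_propForm (φ : PropForm ℕ) :
    (encodingPropForm.encode φ).length = 2 * φ.size + 2 + φ.code.length := by
  change (boolPair (unaryEncodeNat φ.size) φ.code).length = _
  rw [length_boolPair, unaryEncodeNat_eq_replicate, List.length_replicate]

/-- Every variable of `φ` has a numeral shorter than the code word of `φ`. -/
theorem length_encodeNat_lt_length_encode {φ : PropForm ℕ} {v : ℕ} (hv : v ∈ φ.vars) :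
    (encodeNat v).length < (encodingPropForm.encode φ).length := by
  have := length_encodeNat_le_code hv
  rw [length_encode_propForm]
  omega

/-! ### Extension lines in canonical form -/

/-- The variables of a biimplication. -/
theorem vars_biimp (a b : PropForm ℕ) : (PropForm.biimp a b).vars = a.vars ∪ b.vars := by
  ext v
  simp only [PropForm.biimp, PropForm.vars, Finset.mem_union]
  tauto

/-- The variables of an extension line: its extension variable and the variables of its body. -/
theorem mem_vars_extLine {L : ℕ} {it : ℕ × PropForm ℕ} {v : ℕ} :
    v ∈ (extLine L it).vars ↔ v = xvar L it.1 ∨ v ∈ it.2.vars := by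
  rw [extLine, vars_biimp, Finset.mem_union]
  simp [PropForm.vars]

/-- The size of a biimplication `a ↔ b` is `2|a| + 2|b| + 5`. -/
theorem size_biimp (a b : PropForm ℕ) : (PropForm.biimp a b).size = 2 * a.size + 2 * b.size + 5 := by
  simp only [PropForm.biimp, PropForm.size]
  ring

/-- The size of an extension line is `2|ψ| + 7`. -/
theorem size_extLine (L : ℕ) (it : ℕ × PropForm ℕ) : (extLine L it).size = 2 * it.2.size + 7 := by
  have h1 : (PropForm.var (xvar L it.1) : PropForm ℕ).size = 1 := rfl
  rw [extLine, size_biimp, h1]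
  omega

/-- Substitution commutes with `biimp`. -/
theorem biimp_subst (σ : ℕ → PropForm ℕ) (a b : PropForm ℕ) :
    (PropForm.biimp a b).subst σ = PropForm.biimp (a.subst σ) (b.subst σ) := by
  simp [PropForm.biimp, PropForm.subst]

/-! ### Soundness side: canonical certificates are extended-Frege proofs -/

/-- **Canonical certificates are extended-Frege proofs.** Let the extension lines
`xvar L j₀ ↔ ψ₀, xvar L j₁ ↔ ψ₁, …` have strictly increasing indices and bodies `ψ_k` all of whose
variables have numerals of length `≤ L + j_k`, let every variable of `φ` have a numeral of length
`< L`, and let every line of `P` be inferred from the extension lines and the earlier lines of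
`P`, with `P` ending in `φ`. Then `extLines ++ P` is an extended-Frege proof of `φ`: the
extension variable `xvar L j_k` has a numeral of length `L + j_k + 1`, so it occurs neither in
`ψ_k`, nor in `φ`, nor in an earlier extension line. [Cook–Reckhow 1979, §4 Def. 4.1] -/
theorem isEFProofOf_extLines_append {F : FregeSystem} {φ : PropForm ℕ} {L : ℕ}
    {items : List (ℕ × PropForm ℕ)} {P : List (PropForm ℕ)}
    (hchain : items.Pairwise (fun a b => a.1 < b.1))
    (hvb : ∀ it ∈ items, ∀ v ∈ it.2.vars, (encodeNat v).length ≤ L + it.1)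
    (hφ : ∀ v ∈ φ.vars, (encodeNat v).length < L)
    (hinf : ∀ (i : ℕ) (hi : i < P.length), F.IsInferred (items.map (extLine L) ++ P.take i) P[i])
    (hlast : P.getLast? = some φ) :
    F.IsEFProofOf (items.map (extLine L) ++ P) φ := by
  have hl : (items.map (extLine L) ++ P).getLast? = some φ := by
    rw [List.getLast?_append, hlast]
    rfl
  refine ⟨fun k hk => ?_, hl⟩
  by_cases hkE : k < (items.map (extLine L)).length
  · -- an extension line
    right
    rw [List.getElem_append_left hkE, List.take_append_of_le_length hkE.le, List.getElem_map]
    have hk' : k < items.length := by simpa using hkE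
    refine ⟨xvar L items[k].1, items[k].2, rfl, ?_, ?_, ?_⟩
    · intro h
      have := hvb _ (List.getElem_mem hk') _ h
      rw [length_encodeNat_xvar] at this
      omega
    · intro h
      have := hφ _ h
      rw [length_encodeNat_xvar] at this
      omega
    · intro χ hχ hp
      rw [← List.map_take] at hχ
      obtain ⟨it, hit, rfl⟩ := List.mem_map.1 hχ
      obtain ⟨i, hi, hiti⟩ := List.mem_take_iff_getElem.1 hit
      have hik : i < k := by omega
      have hlt : it.1 < items[k].1 := by
        rw [← hiti]
        exact List.pairwise_iff_getElem.1 hchain i k (by omega) hk' hik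
      rcases mem_vars_extLine.1 hp with h | h
      · have := congrArg (fun n => (encodeNat n).length) h
        simp only [length_encodeNat_xvar] at this
        omega
      · have := hvb it (List.mem_of_mem_take hit) _ h
        rw [length_encodeNat_xvar] at this
        omega
  · -- an inferred line
    left
    have hkE' : (items.map (extLine L)).length ≤ k := Nat.le_of_not_lt hkE
    have hkP : k - (items.map (extLine L)).length < P.length := by
      rw [List.length_append] at hk; omega
    rw [List.getElem_append_right hkE', List.take_append, List.take_of_length_le hkE']
    exact hinf _ hkP

/-! ### Counting inferred lines with the Cook–Reckhow translation -/

section Count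

open FregeTransl

/-- A block of the unit-table translation is empty or the single line `⊤`. -/
theorem lineForms_unitTable (rs : List FregeRule) (Es : List (PropForm ℕ)) (θ : PropForm ℕ) :
    lineForms unitTable rs Es θ = [] ∨ lineForms unitTable rs Es θ = [.const true] := by
  rcases lineForms_cases unitTable rs Es θ with h | ⟨r, -, σ, -, -, h⟩
  · exact Or.inl h
  · right; rw [h]; rfl

/-- An inferred line has the block `[⊤]`. -/
theorem lineForms_unitTable_of_isInferred {F : FregeSystem} {Es : List (PropForm ℕ)} {θ : PropForm ℕ}
    (h : F.IsInferred Es θ) : lineForms unitTable F.rules Es θ = [.const true] := by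
  obtain ⟨r, -, σ, -, -, h⟩ := lineForms_of_inferred unitTable F.rules Es θ h
  rw [h]; rfl

/-- A line with a nonempty block is inferred. -/
theorem isInferred_of_lineForms_unitTable_ne_nil {F : FregeSystem} {Es : List (PropForm ℕ)}
    {θ : PropForm ℕ} (h : lineForms unitTable F.rules Es θ ≠ []) : F.IsInferred Es θ := by
  rcases lineForms_cases unitTable F.rules Es θ with h0 | ⟨r, hr, σ, hc, hp, -⟩
  · exact absurd h0 h
  · exact ⟨r, hr, σ, hc, hp⟩

/-- **The translation counts inferred lines.** Appending `P` to `E` lengthens the unit-table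
translation by at most `|P|`, with equality iff every line of `P` is inferred from `E` and the
earlier lines of `P`. -/
theorem length_translForms_unitTable_append (F : FregeSystem) (E P : List (PropForm ℕ)) :
    (translForms unitTable F.rules (E ++ P)).length ≤ (translForms unitTable F.rules E).length + P.length ∧
    ((translForms unitTable F.rules (E ++ P)).length = (translForms unitTable F.rules E).length + P.length ↔
      ∀ (i : ℕ) (hi : i < P.length), F.IsInferred (E ++ P.take i) P[i]) := by
  induction P using List.reverseRecOn with
  | nil => simp
  | append_singleton P θ ih =>
    obtain ⟨ihle, ihiff⟩ := ih
    rw [← List.append_assoc, translForms_append_singleton, List.length_append]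
    have hlen : (P ++ [θ]).length = P.length + 1 := by simp
    -- the forall over `P ++ [θ]` splits into the forall over `P` and the statement for `θ`
    have hsplit : (∀ (i : ℕ) (hi : i < (P ++ [θ]).length), F.IsInferred (E ++ (P ++ [θ]).take i) (P ++ [θ])[i]) ↔
        (∀ (i : ℕ) (hi : i < P.length), F.IsInferred (E ++ P.take i) P[i]) ∧ F.IsInferred (E ++ P) θ := by
      constructor
      · intro H
        refine ⟨fun i hi => ?_, ?_⟩
        · have := H i (by omega)
          rwa [List.getElem_append_left hi, List.take_append_of_le_length hi.le] at this
        · have := H P.length (by omega)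
          rwa [List.getElem_concat_length rfl, List.take_append_of_le_length le_rfl, List.take_length] at this
      · rintro ⟨H1, H2⟩ i hi
        have hi2 : i < P.length + 1 := by omega
        by_cases hi' : i < P.length
        · rw [List.getElem_append_left hi', List.take_append_of_le_length hi'.le]
          exact H1 i hi'
        · have hieq : i = P.length := by omega
          rw [List.getElem_concat_length hieq, List.take_append_of_le_length (by omega), hieq, List.take_length]
          exact H2
    rw [hsplit]
    rcases lineForms_unitTable F.rules (E ++ P) θ with h0 | h1
    · have hni : ¬ F.IsInferred (E ++ P) θ := fun hi => by
        rw [lineForms_unitTable_of_isInferred hi] at h0; simp at h0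
      rw [h0, List.length_nil]
      refine ⟨by omega, ⟨fun h => by omega, fun h => absurd h.2 hni⟩⟩
    · have hinf : F.IsInferred (E ++ P) θ :=
        isInferred_of_lineForms_unitTable_ne_nil (by rw [h1]; simp)
      rw [h1, List.length_singleton]
      refine ⟨by omega, ⟨fun h => ⟨ihiff.1 (by omega), hinf⟩, fun h => by have := ihiff.2 h.1; omega⟩⟩

end Count
end Summit.PneNP.PneNP.Theorems.EFProofSearch
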